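import Summits.CriticalPhenomena.PercolationContinuityZ3.Theorems.PercNearOneGluingNoHeavyLowerTailFKCSHPhiDefs
import Summits.CriticalPhenomena.PercolationContinuityZ3.Theorems.PercNearOneGluingNoHeavyLowerTailCSHUnfoldOneTools
import HarnessLib

/-!
# FK sub-lane: the residual functional `Φ_FK` of the unfolding for `φ_{w,q}` is NONNEGATIVE for `q ≥ 1`

Support file (`--supports stmt-CriticalPhenomena-4575`), FK sub-lane `prim-bschramm-fk-1` (gen 2) of the post-continuity programme;
builds on p205010 (kernel theorem, internal audit signed; external expert review pending).  No definitions, no named facts, no sorries;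
standard axioms.

`FK.phiFK_nonneg`: for `q ≥ 1`, every parameter vector, owner `x`, avoided set `Y`, monotone `g` and vertex set `K`,
`0 ≤ FK.phiFK w q x Y g K` (`…FKCSHPhiDefs.lean`).  Proof: decompose `φ_{G−K̄}` restricted to `{x ↮ Y}` along the classes
`{C_Y = W}`; on each class the configuration off `W̄` is `φ_{G−K̄−W̄}` (van den Berg–Häggström–Kahn's Lemma 2.3 for `φ_{𝐩,q}`, tree
`BHK2006.rcMass_sum_setCl_eq`), so the own-graph residual has mean zero, while the world mean of Lemma T_rc is taken under
`φ_{G−W̄} ≥_st φ_{G−K̄−W̄}` (comparison in `𝐩` for `q ≥ 1`, `BHK2006.sum_rcMass_mono_weights`).  This is the trivial half of Lemma Φ(b)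
for the random-cluster measure; the monotonicity half is the open statement `FK.PhiFKMonotone q`.
[cite: VandenbergHaggstromKahn2005, §2.1 Lemma 2.3 (p. 10)] [cite: Grimmett2006, Thm. (3.21) (p. 44), §1.4 eq. (1.20) (p. 15)]
-/

noncomputable section

namespace Summit.CriticalPhenomena.PercolationContinuityZ3.Theorems

open MeasureTheory Set Literature.Probability.LatticeModels Literature.Probability.Percolation
open scoped Classical
open BHK2006 DecisionTree HullPort

namespace FK

variable {V : Type*} [Fintype V]

/-! ### `Φ_FK ≥ 0` for `q ≥ 1` -/

/-- **`Φ_FK ≥ 0` for `q ≥ 1`.**  Given the cluster `W` of `Y` under `φ_{G−K̄}` (with `x ∉ W`), the configuration off `W̄` is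
`φ_{G−K̄−W̄}` (van den Berg–Häggström–Kahn's Lemma 2.3 for `φ_{𝐩,q}`, `rcMass_sum_setCl_eq`), which is dominated by the world
`φ_{G−W̄}` of the world mean (comparison in `𝐩`, `sum_rcMass_mono_weights`, `q ≥ 1`); the own-graph residual has mean zero class by class.
[cite: VandenbergHaggstromKahn2005, §2.1 Lemma 2.3 (p. 10)] [cite: Grimmett2006, Thm. (3.21) (comparison in 𝐩)] -/
theorem phiFK_nonneg (w : Sym2 V → unitInterval) {q : ℝ} (hq : 1 ≤ q) (x : V) (Y : Set V) {g : Set (Sym2 V) → ℝ}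
    (hg : Monotone g) (K : Set V) : 0 ≤ phiFK w q x Y g K := by
  classical
  have hq0 : 0 < q := one_pos.trans_le hq
  set wK : Sym2 V → unitInterval := delW w (CSH.edgesOf K) with hwK
  set G : Set (Sym2 V) → ℝ := fun η => g (openEdgeCluster η x) with hG
  have hGmono : Monotone G := fun η η' h => hg (openEdgeCluster_mono h x)
  -- the own-graph world mean (worlds of `G − K̄`) is dominated by the world mean in `G`
  set wm : BondConfig V → ℝ := fun ω => ∑ η, rcMass (delW wK (cut Y ω)) q η * G η with hwm
  have hdom : ∀ ω, wm ω ≤ worldMeanY w q x Y g ω := by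
    intro ω
    have e1 : worldMeanY w q x Y g ω = ∑ η, rcMass (delW w (cut Y ω)) q η * G η := by
      unfold worldMeanY
      exact integral_rcMeasureW_eq_sum (delW w (cut Y ω)) hq0 G
    rw [e1]
    refine sum_rcMass_mono_weights (fun e => ?_) hq hGmono
    show delW wK (cut Y ω) e ≤ delW w (cut Y ω) e
    by_cases h1 : e ∈ cut Y ω
    · simp only [delW, if_pos h1]; exact le_rfl
    · simp only [delW, if_neg h1, hwK]
      by_cases h2 : e ∈ CSH.edgesOf K
      · rw [if_pos h2]; exact Subtype.coe_le_coe.1 (by simp only [Set.Icc.coe_zero]; exact unitInterval.nonneg _)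
      · rw [if_neg h2]
  -- the event `{x ↮ Y}` and its indicator
  have hD : {ω : BondConfig V | ∀ y ∈ Y, ¬ (openGraph ω).Reachable x y} = avoidEv x Y := rfl
  unfold phiFK
  rw [hD, setIntegral_rcMeasureW_eq_sum wK hq0]
  -- lower bound, term by term
  have hlb : ∑ ω, rcMass wK q ω * ((wm ω - G ω) * ind (avoidEv x Y) ω) ≤
      ∑ ω, rcMass wK q ω * ((worldMeanY w q x Y g ω - g (openEdgeCluster ω x)) * ind (avoidEv x Y) ω) := by
    refine Finset.sum_le_sum fun ω _ => mul_le_mul_of_nonneg_left ?_ (rcMass_nonneg wK hq0 ω)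
    exact mul_le_mul_of_nonneg_right (sub_le_sub_right (hdom ω) _) (ind_nonneg _ _)
  refine le_trans (le_of_eq ?_) hlb
  -- the own-graph residual has mean zero: decompose along the classes `{setCl ω Y = W}`
  symm
  have hind : ∀ ω : BondConfig V, ind (avoidEv x Y) ω =
      (if (x ∈ Y ∨ ∃ e ∈ setCl ω Y, x ∈ e) then (0 : ℝ) else 1) := by
    intro ω
    by_cases h : (x ∈ Y ∨ ∃ e ∈ setCl ω Y, x ∈ e)
    · rw [if_pos h, ind_of_not_mem (fun h' => (CSH.mem_avoidEv_iff_notMem_span x Y ω).1 h' h)]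
    · rw [if_neg h, ind_of_mem ((CSH.mem_avoidEv_iff_notMem_span x Y ω).2 h)]
  -- on `avoidEv`, `G ω = G (ω ∖ cut Y ω)`; and `cut Y ω = barOf Y (setCl ω Y)`
  have hterm : ∀ ω : BondConfig V, rcMass wK q ω * ((wm ω - G ω) * ind (avoidEv x Y) ω) =
      ∑ W : Set (Sym2 V), (if setCl ω Y = W then
        (if (x ∈ Y ∨ ∃ e ∈ W, x ∈ e) then (0 : ℝ) else 1) *
          (rcMass wK q ω * (∑ η, rcMass (delW wK (barOf Y W)) q η * G η) - rcMass wK q ω * G (ω \ barOf Y W)) else 0) := by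
    intro ω
    rw [Fintype.sum_ite_eq (setCl ω Y) (fun W => (if (x ∈ Y ∨ ∃ e ∈ W, x ∈ e) then (0 : ℝ) else 1) *
          (rcMass wK q ω * (∑ η, rcMass (delW wK (barOf Y W)) q η * G η) - rcMass wK q ω * G (ω \ barOf Y W)))]
    rw [hind ω, ← cut_eq_barOf]
    by_cases h : (x ∈ Y ∨ ∃ e ∈ setCl ω Y, x ∈ e)
    · rw [if_pos h]; ring
    · rw [if_neg h]
      have hav : ω ∈ avoidEv x Y := (CSH.mem_avoidEv_iff_notMem_span x Y ω).2 h
      rw [show G ω = G (ω \ cut Y ω) by simp only [hG, CSH.openEdgeCluster_sdiff_cut_of_avoid hav]]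
      simp only [hwm]
      ring
  rw [Finset.sum_congr rfl fun ω _ => hterm ω, Finset.sum_comm]
  refine Finset.sum_eq_zero fun W _ => ?_
  -- class `W`: `χ(W) · (mass(W) · worldmean_K(W) − Σ_{class} rcMass · G(ω ∖ barOf))` vanishes by Lemma 2.3
  have key := rcMass_sum_setCl_eq wK hq0 Y W G
  have e1 : ∑ ω, (if setCl ω Y = W then
        (if (x ∈ Y ∨ ∃ e ∈ W, x ∈ e) then (0 : ℝ) else 1) *
          (rcMass wK q ω * (∑ η, rcMass (delW wK (barOf Y W)) q η * G η) - rcMass wK q ω * G (ω \ barOf Y W)) else 0) =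
      (if (x ∈ Y ∨ ∃ e ∈ W, x ∈ e) then (0 : ℝ) else 1) *
        ((∑ ω, (if setCl ω Y = W then rcMass wK q ω else 0)) * (∑ η, rcMass (delW wK (barOf Y W)) q η * G η) -
          ∑ ω, (if setCl ω Y = W then rcMass wK q ω * G (ω \ barOf Y W) else 0)) := by
    rw [mul_sub, Finset.sum_mul, Finset.mul_sum, Finset.mul_sum, ← Finset.sum_sub_distrib]
    refine Finset.sum_congr rfl fun ω _ => ?_
    split_ifs <;> ring
  rw [e1, key, sub_self, mul_zero]

end FK

end Summit.CriticalPhenomena.PercolationContinuityZ3.Theorems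

end
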